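import Literature.NumberTheory.Rogawski1990.ArchBouazizSpaceH          -- ★ (D2-P1) p849592: (P) (W) (I₁)+(I₂) (I₄), `bzBumpFamily` (Q1), rejections (Q2)
import Literature.NumberTheory.Rogawski1990.ArchBouazizJumpClause      -- ★ (D2-I3) p849586 (LH7-p02 (g2)): (I₃) `ArchBzJump jcH Ψ`, `bzTwistedDeriv`, `ArchBzJump.order_zero`
import Mathlib.Data.Real.Sign
import HarnessLib

/-!
# `ArchBouazizSpaceH jcH Ψ` — Bouaziz's space `I^st_c(H_∞)` as ONE predicate on Cartan-indexed families (the conjunction (P) ∧ (W) ∧ (I₁+I₂) ∧ (I₃) ∧ (I₄)); its NON-ZERO inhabitant;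
# a family the jump clause ALONE rejects; the covered-wall bookkeeping `AgreesOnCovered` (Bouaziz 1994 §3.2 p. 580, §6.2 p. 591, Thm. 6.2.1; Shelstad 1979 §4)

Topic `NumberTheory/Rogawski1990`; namespace `Literature.NumberTheory.Rogawski1990`.  Definitions WITH BODIES and theorems only (no instance, no notation, no axiom, no named
fact, no `sorry`).  Cell `pub/hodgecm-mathlib`, line LH3 (closer stub `stub_N9`, crux H413 = `stmt-HodgeConjecture-24833`); organ **(D2-P2b)** = «D2-pack» of the LH3 direct road
(LH3-plan (g2) word 2026-09-02T05:42:00Z; PACK-SPEC v1 §3; D2-SPEC v2 rulings; LHref-N pre-flags Q1 ∕ Q2 ∕ F7).  Author LH3-p01 (g3).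

WHAT IS HERE.
* §1 **`ArchBouazizSpaceH (jcH : Finset W → W → ℂ) (Ψ : Finset W → (W → Fin 3 → ℝ) → ℂ) : Prop`** — the conjunction of ★ `ArchBzPeriodic`, ★ `ArchBzWeyl`, ★ `ArchBzSmoothBounded`
  ((I₁)+(I₂) bundled), ★ `ArchBzJump jcH` (LH7-p02), ★ `ArchBzCompactSupport`; projections; `_iff`.  ONE jump constant `jcH S w` per wall (no `k`: v2 F2).  This is the TYPE of the
  target of the transfer organ O-L2 and of the letter O-L3′ (Bouaziz's surjectivity, PACK-SPEC §4).
* §2 **`archBzJump_of_eventuallyEq_zero`** — the clean cut for (I₃): a family that vanishes near every semiregular wall point on the chart `S` AND near its Cayley point on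
  `insert w₀ S` satisfies the jump clause with ANY constants (both twisted one-sided limits are `0`, and so is the Cayley-side reading); hence `archBzJump_zero`,
  `archBouazizSpaceH_zero` (the zero family is in the space for every `jcH`).
* §3 **Q1 IN THE FULL SPACE: `archBouazizSpaceH_bzBumpFamily (jcH) : ArchBouazizSpaceH jcH bzBumpFamily`** for EVERY `jcH` — the totally split bump family of ★ (D2-P1) is flat at
  every real wall (★ `bzBump_eq_zero_of_le_one`) and zero off the totally split chart, so its (I₃) reads `0 = jcH · 0` (Shelstad's Lemma 4.8 (b) phenomenon: a non-zero
  element of `I^st_c` invisible on every compact Cartan).  With ★ `bzBumpFamily_ne_zero`: the predicate is NON-VACUOUS for every choice of constants.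
* §4 **Q2 BY (I₃) ALONE: `not_archBzJump_signSinFamily`** — the family `Ψ ∅ c = sgn sin((θ₀−θ₂)∕2)` at one compact place `w₀` (else `0`) has an ORDER-0 jump `2` across the
  wall while the Cayley-side reading is `jcH · Ψ {w₀} (cayPt) = 0`: rejected for EVERY `jcH` (★ `ArchBzJump.order_zero` + uniqueness of one-sided limits).  It is the
  coordinate shadow of an UNSTABLE (κ-)orbital combination — smooth off the walls, periodic, bounded — exactly what `I^st` must exclude.  (LHref-N F7's `|sin(Δ∕2)|·bump` is the
  order-1 twin; the order-0 witness needs no differentiability bookkeeping.)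
* §5 covered-wall bookkeeping for the junction with the `G′`-side space (PACK-SPEC §3): `IsIndefiniteAt s w`, `IsCoveredWall s S w` (`w ∉ S` and the place is indefinite),
  `bzTheta odd p jc′ S w := 2 · jc′ S w (odd w) (p w)` (`d = 1` on both sides, the stable pair ADDS — MEMO v2-delta C2; `odd p : W → Fin 3` explicit until the atlas PART 2 fixes
  them), `AgreesOnCovered s odd p jc′ jcH`.
HONEST LABEL: HC_CM is proved only modulo the 7 printed citations (2 remaining: hLiu418 = stmt-HodgeConjecture-24832, h413 = stmt-HodgeConjecture-24833) until rung 0 closes; this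
file types the target space of a LETTER (O-L3′) and pays nothing by itself.

## References
* [Bouaziz1994IntegralesOrbitales] A. Bouaziz, *Intégrales orbitales sur les groupes de Lie réductifs*, Ann. Sci. ÉNS 27 (1994) 573–609, §3.1–3.2 pp. 579–580 ((I₁)–(I₄)), §6.2
  p. 591 (`I^st`), Thm. 6.2.1 (i) p. 592, Rem. 2 p. 594 («Transf»).
* [Shelstad1979] D. Shelstad, *Characters and inner forms of a quasi-split group over ℝ*, Compositio Math. 39 (1979), §4: Thm. 4.7 p. 31, Lemma 4.8 p. 31–32 ((b): functions in
  the image vanishing on every compact Cartan), Lemma 4.3 p. 25.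
* [Rogawski1990] J. D. Rogawski, *Automorphic Representations of Unitary Groups in Three Variables*, Ann. of Math. Stud. 123 (1990), §8.2 p. 119 (the unstable combination
  `Φ(γ) − Φ(γ″)` jumps), §14.3 p. 234.
-/

set_option autoImplicit false

noncomputable section

open Filter Topology Complex Set Function Real
open scoped ContDiff
open Literature.NumberTheory.Automorphic.Shelstad1979.StableOrbitalIntegrals
open Literature.NumberTheory.Automorphic.ArchCartan

namespace Literature.NumberTheory.Rogawski1990

variable {W : Type*} [Fintype W] [DecidableEq W]

/-! ## §1 The predicate `ArchBouazizSpaceH` -/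

/-- **`ArchBouazizSpaceH jcH Ψ` — Bouaziz's space `I^st_c(H_∞)` of jump data `jcH`, as a predicate on Cartan-indexed coordinate families** `Ψ : Finset W → (W → Fin 3 → ℝ) → ℂ`
(`Ψ S` = the `R_T`-normalised stable orbital reading on the Cartan of type `S`): periodic in the angles (P), stably Weyl-symmetric (W), smooth on `T_{in-reg}` with bounded
derivatives near the walls (I₁)+(I₂), Bouaziz's jump relations at the noncompact imaginary walls with the constants `jcH S w` (I₃), compactly supported modulo conjugation (I₄).
«`I(U)` l'espace des fonctions `φ` … vérifiant (I₁)–(I₄)» (§3.1–3.2), stable version `I^st` (§6.2).  The conjunction of ★ `ArchBzPeriodic`, ★ `ArchBzWeyl`, ★ `ArchBzSmoothBounded`,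
★ `ArchBzJump`, ★ `ArchBzCompactSupport`. [cite: Bouaziz1994IntegralesOrbitales, §3.2 p. 580; §6.2 p. 591] [cite: Shelstad1979, Thm. 4.7 (p. 31)] -/
def ArchBouazizSpaceH (jcH : Finset W → W → ℂ) (Ψ : Finset W → (W → Fin 3 → ℝ) → ℂ) : Prop :=
  ArchBzPeriodic Ψ ∧ ArchBzWeyl Ψ ∧ ArchBzSmoothBounded Ψ ∧ ArchBzJump jcH Ψ ∧ ArchBzCompactSupport Ψ

/-- Unfolding of `ArchBouazizSpaceH`. [cite: Bouaziz1994IntegralesOrbitales, §3.2 p. 580] -/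
theorem archBouazizSpaceH_iff (jcH : Finset W → W → ℂ) (Ψ : Finset W → (W → Fin 3 → ℝ) → ℂ) :
    ArchBouazizSpaceH jcH Ψ ↔ ArchBzPeriodic Ψ ∧ ArchBzWeyl Ψ ∧ ArchBzSmoothBounded Ψ ∧ ArchBzJump jcH Ψ ∧ ArchBzCompactSupport Ψ :=
  Iff.rfl

/-- Projection (P). [cite: Bouaziz1994IntegralesOrbitales, §3.1 p. 579] -/
theorem ArchBouazizSpaceH.periodic {jcH : Finset W → W → ℂ} {Ψ : Finset W → (W → Fin 3 → ℝ) → ℂ} (h : ArchBouazizSpaceH jcH Ψ) : ArchBzPeriodic Ψ :=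
  h.1

/-- Projection (W). [cite: Shelstad1979, §4 (p. 23)] -/
theorem ArchBouazizSpaceH.weyl {jcH : Finset W → W → ℂ} {Ψ : Finset W → (W → Fin 3 → ℝ) → ℂ} (h : ArchBouazizSpaceH jcH Ψ) : ArchBzWeyl Ψ :=
  h.2.1

/-- Projection (I₁)+(I₂). [cite: Bouaziz1994IntegralesOrbitales, §3.1 p. 579] -/
theorem ArchBouazizSpaceH.smoothBounded {jcH : Finset W → W → ℂ} {Ψ : Finset W → (W → Fin 3 → ℝ) → ℂ} (h : ArchBouazizSpaceH jcH Ψ) : ArchBzSmoothBounded Ψ :=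
  h.2.2.1

/-- Projection (I₃). [cite: Bouaziz1994IntegralesOrbitales, §3.2 (I₃) p. 580] -/
theorem ArchBouazizSpaceH.jump {jcH : Finset W → W → ℂ} {Ψ : Finset W → (W → Fin 3 → ℝ) → ℂ} (h : ArchBouazizSpaceH jcH Ψ) : ArchBzJump jcH Ψ :=
  h.2.2.2.1

/-- Projection (I₄). [cite: Bouaziz1994IntegralesOrbitales, §3.1 p. 579] -/
theorem ArchBouazizSpaceH.compactSupport {jcH : Finset W → W → ℂ} {Ψ : Finset W → (W → Fin 3 → ℝ) → ℂ} (h : ArchBouazizSpaceH jcH Ψ) : ArchBzCompactSupport Ψ :=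
  h.2.2.2.2

/-! ## §2 The clean cut for (I₃): families vanishing near the walls -/

/-- **A family that VANISHES near every semiregular wall point (on its chart) and near the corresponding Cayley point (on the adjacent split chart) satisfies (I₃) with ANY constants**:
both twisted one-sided limits along the normal curve are `0` (the twisted iterated derivative is eventually `0` near `ν = 0`, Mathlib `Filter.EventuallyEq.iteratedFDeriv`), and the
Cayley-side reading `(eρ_{S′})⁻¹ Dⁿ(eρ_{S′} Ψ_{S′})(cayPt)` is `0` too, so the relation reads `0 − 0 = jcH · I^k · 0`. [cite: Bouaziz1994IntegralesOrbitales, §3.2 (I₃) p. 580]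
[cite: Shelstad1979, Lemma 4.8 (p. 31)] -/
theorem archBzJump_of_eventuallyEq_zero {jcH : Finset W → W → ℂ} {Ψ : Finset W → (W → Fin 3 → ℝ) → ℂ}
    (h : ∀ (S : Finset W) (w₀ : W), w₀ ∉ S → ∀ s : W → Fin 3 → ℝ, s w₀ 0 = s w₀ 2 →
      (∀ w, w ∉ S → w ≠ w₀ → Circle.exp (s w 0) ≠ Circle.exp (s w 2)) → (∀ w ∈ S, s w 0 ≠ 0) →
      (Ψ S =ᶠ[𝓝 s] fun _ => 0) ∧ (Ψ (insert w₀ S) =ᶠ[𝓝 (cayPt w₀ s)] fun _ => 0)) :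
    ArchBzJump jcH Ψ := by
  intro S w₀ hw₀ s hs hreg hregS n m
  obtain ⟨h1, h2⟩ := h S w₀ hw₀ s hs hreg hregS
  -- the twisted products vanish near the two points
  have h1' : (fun c => archERho S c * Ψ S c) =ᶠ[𝓝 s] fun _ => 0 := by
    filter_upwards [h1] with c hc
    simp only [hc, mul_zero]
  have h2' : (fun c => archERho (insert w₀ S) c * Ψ (insert w₀ S) c) =ᶠ[𝓝 (cayPt w₀ s)] fun _ => 0 := by
    filter_upwards [h2] with c hc
    simp only [hc, mul_zero]
  have hD1 := h1'.iteratedFDeriv ℝ n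
  have hD2 := (h2'.iteratedFDeriv ℝ n).eq_of_nhds
  -- the Cayley-side reading is `0`
  have hR : bzTwistedDeriv (insert w₀ S) n (fun j => bzCayVec (m j)) (Ψ (insert w₀ S)) (cayPt w₀ s) = 0 := by
    unfold bzTwistedDeriv
    rw [hD2, iteratedFDeriv_fun_zero, Pi.zero_apply, zero_apply, mul_zero]
  -- the twisted derivative along the normal curve is eventually `0` near `ν = 0`
  have hcurve : Tendsto (fun ν : ℝ => s + ν • nrm w₀) (𝓝 0) (𝓝 s) := by
    have hc : Continuous fun ν : ℝ => s + ν • nrm w₀ := continuous_const.add (continuous_id.smul continuous_const)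
    simpa only [zero_smul, add_zero] using hc.tendsto 0
  have hL : (fun ν : ℝ => bzTwistedDeriv S n (fun j => bzAdaptedVec w₀ (m j)) (Ψ S) (s + ν • nrm w₀)) =ᶠ[𝓝 0] fun _ => 0 := by
    filter_upwards [hcurve.eventually hD1] with ν hν
    unfold bzTwistedDeriv
    rw [hν, iteratedFDeriv_fun_zero, Pi.zero_apply, zero_apply, mul_zero]
  refine ⟨0, 0, ?_, ?_, ?_⟩
  · exact tendsto_const_nhds.congr' (hL.filter_mono nhdsWithin_le_nhds).symm
  · exact tendsto_const_nhds.congr' (hL.filter_mono nhdsWithin_le_nhds).symm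
  · rw [hR, mul_zero, sub_self]

/-- The zero family satisfies (I₃) for every `jcH`. [cite: Bouaziz1994IntegralesOrbitales, §3.2 (I₃) p. 580] -/
theorem archBzJump_zero (jcH : Finset W → W → ℂ) : ArchBzJump jcH (fun (_ : Finset W) (_ : W → Fin 3 → ℝ) => (0 : ℂ)) :=
  archBzJump_of_eventuallyEq_zero fun _ _ _ _ _ _ _ => ⟨EventuallyEq.rfl, EventuallyEq.rfl⟩

/-- **The zero family is in `I^st_c` for every `jcH`** (the predicate is consistent). [cite: Bouaziz1994IntegralesOrbitales, §3.2 p. 580] -/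
theorem archBouazizSpaceH_zero (jcH : Finset W → W → ℂ) : ArchBouazizSpaceH jcH (fun (_ : Finset W) (_ : W → Fin 3 → ℝ) => (0 : ℂ)) :=
  ⟨archBzPeriodic_zero, archBzWeyl_zero, archBzSmoothBounded_zero, archBzJump_zero jcH, archBzCompactSupport_zero⟩

/-! ## §3 Q1 in the full space: the totally split bump family, for EVERY `jcH` -/

/-- The totally split bump family vanishes near every point whose `x_{w₀}`-slot is `0` (it is flat there, ★ `bzBump_eq_zero_of_le_one`; off the totally split chart it is `0` anyway).
[cite: Shelstad1979, Lemma 4.8 (p. 31)] -/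
theorem bzBumpFamily_eventuallyEq_zero_of_apply_eq_zero (S : Finset W) {w₀ : W} {c₀ : W → Fin 3 → ℝ} (hc₀ : c₀ w₀ 0 = 0) :
    bzBumpFamily S =ᶠ[𝓝 c₀] fun (_ : W → Fin 3 → ℝ) => (0 : ℂ) := by
  by_cases hS : S = Finset.univ
  · subst hS
    rw [bzBumpFamily_univ]
    have hU : IsOpen {c : W → Fin 3 → ℝ | |c w₀ 0| < 1} :=
      isOpen_lt (continuous_abs.comp ((continuous_apply 0).comp (continuous_apply w₀))) continuous_const
    have hmem : c₀ ∈ {c : W → Fin 3 → ℝ | |c w₀ 0| < 1} := by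
      show |c₀ w₀ 0| < 1
      rw [hc₀, abs_zero]
      exact one_pos
    filter_upwards [hU.mem_nhds hmem] with c hc
    exact Finset.prod_eq_zero (Finset.mem_univ w₀) (by rw [bzBump_eq_zero_of_le_one (le_of_lt hc), Complex.ofReal_zero])
  · rw [bzBumpFamily_of_ne_univ hS]

/-- **(I₃) for the bump family, ANY constants**: on a chart `S` with a compact place `w₀ ∉ S` the family is `0` (`S ≠ univ`), and on `insert w₀ S` it vanishes near the Cayley point
(whose `x_{w₀}` is `0`, ★ `cayPt_apply_self_zero`) — so every jump relation reads `0 = jcH · 0`. [cite: Shelstad1979, Lemma 4.8 (b) (p. 31)] [cite: Bouaziz1994IntegralesOrbitales, §3.2 (I₃) p. 580] -/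
theorem archBzJump_bzBumpFamily (jcH : Finset W → W → ℂ) : ArchBzJump jcH (bzBumpFamily (W := W)) := by
  refine archBzJump_of_eventuallyEq_zero fun S w₀ hw₀ s _ _ _ => ⟨?_, ?_⟩
  · have hS : S ≠ Finset.univ := fun h => hw₀ (h ▸ Finset.mem_univ w₀)
    rw [bzBumpFamily_of_ne_univ hS]
  · exact bzBumpFamily_eventuallyEq_zero_of_apply_eq_zero (insert w₀ S) (cayPt_apply_self_zero w₀ s)

/-- **Q1 — `I^st_c(jcH)` HAS A NON-ZERO ELEMENT FOR EVERY `jcH`**: the totally split bump family of ★ (D2-P1) satisfies all five clauses (★ `archBzPeriodic_∕archBzWeyl_∕archBzSmoothBounded_∕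
archBzCompactSupport_bzBumpFamily` + `archBzJump_bzBumpFamily`), and ★ `bzBumpFamily_ne_zero`. [cite: Shelstad1979, Lemma 4.8 (b) (p. 31)] [cite: Bouaziz1994IntegralesOrbitales, Thm. 6.2.1 (i) p. 592] -/
theorem archBouazizSpaceH_bzBumpFamily (jcH : Finset W → W → ℂ) : ArchBouazizSpaceH jcH (bzBumpFamily (W := W)) :=
  ⟨archBzPeriodic_bzBumpFamily, archBzWeyl_bzBumpFamily, archBzSmoothBounded_bzBumpFamily, archBzJump_bzBumpFamily jcH, archBzCompactSupport_bzBumpFamily⟩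

/-- Hence `I^st_c(jcH)` is not reduced to `{0}`, for any `jcH`. [cite: Shelstad1979, Lemma 4.8 (b) (p. 31)] -/
theorem exists_archBouazizSpaceH_ne_zero (jcH : Finset W → W → ℂ) : ∃ Ψ : Finset W → (W → Fin 3 → ℝ) → ℂ, ArchBouazizSpaceH jcH Ψ ∧ Ψ ≠ fun _ _ => 0 :=
  ⟨bzBumpFamily, archBouazizSpaceH_bzBumpFamily jcH, bzBumpFamily_ne_zero⟩

/-! ## §4 Q2 by (I₃) alone: the sign family at one compact place -/

/-- **`signSinFamily w₀`** — on the all-compact chart `S = ∅` the function `sgn sin((θ₀ − θ₂)∕2)` of the `w₀`-block angles (`±1` on the two sides of the wall `θ₀ = θ₂`, locally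
constant — hence smooth and bounded with all derivatives — off the walls `θ₀ − θ₂ ∈ 2πℤ`, `2π`-periodic), `0` on every other chart: the coordinate shadow of an UNSTABLE combination of
orbital integrals («`Φ(γ, f) − Φ(γ″, f)`», which jumps at the wall). [cite: Rogawski1990, §8.2 p. 119] [cite: Shelstad1979, §4 (p. 23)] -/
def signSinFamily (w₀ : W) (S : Finset W) (c : W → Fin 3 → ℝ) : ℂ :=
  if S = ∅ then (Real.sign (Real.sin ((c w₀ 0 - c w₀ 2) / 2)) : ℂ) else 0

omit [Fintype W] in
/-- Along the normal curve at a wall point (`s w₀ 0 = s w₀ 2`) the sign family reads `sgn sin ν`. [cite: Rogawski1990, §8.2 p. 122] -/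
theorem signSinFamily_empty_add_smul_nrm (w₀ : W) {s : W → Fin 3 → ℝ} (hs : s w₀ 0 = s w₀ 2) (ν : ℝ) :
    signSinFamily w₀ ∅ (s + ν • nrm w₀) = (Real.sign (Real.sin ν) : ℂ) := by
  rw [signSinFamily, if_pos rfl, add_smul_nrm_gap, hs, sub_self, zero_add, mul_div_cancel_left₀ ν two_ne_zero]

omit [Fintype W] in
/-- On `(0, π)` the reading is `1`. [cite: Rogawski1990, §8.2 p. 122] -/
theorem signSinFamily_eventually_nhdsGT (w₀ : W) {s : W → Fin 3 → ℝ} (hs : s w₀ 0 = s w₀ 2) :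
    (fun ν : ℝ => signSinFamily w₀ ∅ (s + ν • nrm w₀)) =ᶠ[𝓝[>] (0 : ℝ)] fun _ => (1 : ℂ) := by
  filter_upwards [Ioo_mem_nhdsGT Real.pi_pos] with ν hν
  rw [signSinFamily_empty_add_smul_nrm w₀ hs, Real.sign_of_pos (Real.sin_pos_of_pos_of_lt_pi hν.1 hν.2), Complex.ofReal_one]

omit [Fintype W] in
/-- On `(−π, 0)` the reading is `−1`. [cite: Rogawski1990, §8.2 p. 122] -/
theorem signSinFamily_eventually_nhdsLT (w₀ : W) {s : W → Fin 3 → ℝ} (hs : s w₀ 0 = s w₀ 2) :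
    (fun ν : ℝ => signSinFamily w₀ ∅ (s + ν • nrm w₀)) =ᶠ[𝓝[<] (0 : ℝ)] fun _ => (-1 : ℂ) := by
  filter_upwards [Ioo_mem_nhdsLT (neg_lt_zero.2 Real.pi_pos)] with ν hν
  rw [signSinFamily_empty_add_smul_nrm w₀ hs, Real.sign_of_neg (Real.sin_neg_of_neg_of_neg_pi_lt hν.2 hν.1), Complex.ofReal_neg, Complex.ofReal_one]

omit [Fintype W] in
/-- A semiregular point of the wall at `w₀` on the all-compact chart: `(0, 0, 0)` at `w₀`, `(0, 0, π)` elsewhere (`e^{0} = 1 ≠ −1 = e^{iπ}`). [cite: Shelstad1979, §4 (p. 22)] -/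
theorem exists_semiregular_wall_point (w₀ : W) :
    ∃ s : W → Fin 3 → ℝ, s w₀ 0 = s w₀ 2 ∧ (∀ w, w ∉ (∅ : Finset W) → w ≠ w₀ → Circle.exp (s w 0) ≠ Circle.exp (s w 2)) ∧ ∀ w ∈ (∅ : Finset W), s w 0 ≠ 0 := by
  refine ⟨Function.update (fun _ => ![(0 : ℝ), 0, π]) w₀ 0, ?_, fun w _ hw => ?_, fun w hw => absurd hw (Finset.notMem_empty w)⟩
  · simp only [Function.update_self, Pi.zero_apply]
  · rw [Function.update_of_ne hw]
    simp only [Matrix.cons_val_zero, Matrix.cons_val_two, Matrix.tail_cons, Matrix.head_cons]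
    intro h
    have h1 := congrArg (fun z : Circle => (z : ℂ)) h
    simp only [Circle.coe_exp, Complex.ofReal_zero, zero_mul, Complex.exp_zero, Complex.exp_pi_mul_I] at h1
    norm_num at h1

/-- **Q2 — THE JUMP CLAUSE ALONE REJECTS THE SIGN FAMILY, FOR EVERY `jcH`**: at a semiregular point of the wall at `w₀` the order-`0` reading of (I₃) (★ `ArchBzJump.order_zero`) would
give one-sided limits `Lp`, `Lm` of `ν ↦ sgn sin ν` with `Lp − Lm = jcH ∅ w₀ · Ψ {w₀} (cayPt) = 0`; but `Lp = 1`, `Lm = −1` (uniqueness of limits on the non-trivial filters `𝓝[>] 0`,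
`𝓝[<] 0`). [cite: Bouaziz1994IntegralesOrbitales, §3.2 (I₃) p. 580] [cite: Rogawski1990, §8.2 p. 119] -/
theorem not_archBzJump_signSinFamily (jcH : Finset W → W → ℂ) (w₀ : W) : ¬ ArchBzJump jcH (signSinFamily w₀) := by
  intro h
  obtain ⟨s, hs, hreg, hregS⟩ := exists_semiregular_wall_point w₀
  obtain ⟨Lp, Lm, hp, hm, hJ⟩ := h.order_zero (Finset.notMem_empty w₀) hs hreg hregS
  have hp1 : Tendsto (fun ν : ℝ => signSinFamily w₀ ∅ (s + ν • nrm w₀)) (𝓝[>] (0 : ℝ)) (𝓝 (1 : ℂ)) :=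
    tendsto_const_nhds.congr' (signSinFamily_eventually_nhdsGT w₀ hs).symm
  have hm1 : Tendsto (fun ν : ℝ => signSinFamily w₀ ∅ (s + ν • nrm w₀)) (𝓝[<] (0 : ℝ)) (𝓝 (-1 : ℂ)) :=
    tendsto_const_nhds.congr' (signSinFamily_eventually_nhdsLT w₀ hs).symm
  have hLp : Lp = 1 := tendsto_nhds_unique hp hp1
  have hLm : Lm = -1 := tendsto_nhds_unique hm hm1
  have hzero : signSinFamily w₀ (insert w₀ ∅) (cayPt w₀ s) = 0 := by
    rw [signSinFamily, if_neg (Finset.insert_ne_empty w₀ ∅)]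
  rw [hLp, hLm, hzero, mul_zero] at hJ
  norm_num at hJ

/-- Hence the sign family is NOT in `I^st_c(jcH)`, whatever `jcH` (the predicate has teeth: it excludes the unstable combinations). [cite: Bouaziz1994IntegralesOrbitales, §6.2 p. 591] -/
theorem not_archBouazizSpaceH_signSinFamily (jcH : Finset W → W → ℂ) (w₀ : W) : ¬ ArchBouazizSpaceH jcH (signSinFamily w₀) :=
  fun h => not_archBzJump_signSinFamily jcH w₀ h.jump

/-! ## §5 Covered walls and the junction of the two jump-constant systems (PACK-SPEC §3) -/

omit [Fintype W] [DecidableEq W] in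
/-- **The place `w` is INDEFINITE for the sign pattern `s`** (`s w i = sgn re σ_w(α_i)` of the diagonal form `diag α`): the three signs are not all equal (`G′_w = U(2,1)`, not `U(3)`).
[cite: Rogawski1990, §14.2 p. 232] -/
def IsIndefiniteAt (s : W → Fin 3 → SignType) (w : W) : Prop :=
  ¬ (s w 0 = s w 1 ∧ s w 1 = s w 2)

omit [Fintype W] [DecidableEq W] in
/-- **A COVERED wall** of the `H`-chart `S`: a compact place `w ∉ S` (so the chart has its noncompact imaginary wall there) which is indefinite for `G′` (so `G′_w` has noncompact Cartans
and the wall is met by partners; at a definite place the `Δ″`-side has no partner for the adjacent split chart — ★ `ArchDefinitePlaceNoSplitPartner`). [cite: Rogawski1990, §8.2 p. 119; §14.2 p. 232] -/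
def IsCoveredWall (s : W → Fin 3 → SignType) (S : Finset W) (w : W) : Prop :=
  w ∉ S ∧ IsIndefiniteAt s w

omit [Fintype W] [DecidableEq W] in
/-- **`bzTheta odd p jc′ S w = 2 · jc′ S w (odd w) (p w)`** — the `H`-side jump constant predicted from the `G′`-side one at a covered wall: `d = 1` on BOTH sides (neither reflection is
realised in its own group) and the two noncompact-adjacent partner classes with EQUAL `κ` ADD at the `H`-wall, whence the factor `2` (MEMO v2-delta C2, the κ-TABLE of D2′-SPEC §3);
`odd w`, `p w` = the odd line and the chosen majority line of the `G′`-chart at `w` (explicit arguments until the atlas fixes them). [cite: Shelstad1979, Lemma 4.3 (p. 25); Thm. 4.7 (IIIb) (p. 31)]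
[cite: Rogawski1990, §8.2 Prop. 8.2.1 (c) p. 119] -/
def bzTheta (odd p : W → Fin 3) (jc' : Finset W → W → Fin 3 → Fin 3 → ℂ) (S : Finset W) (w : W) : ℂ :=
  2 * jc' S w (odd w) (p w)

omit [Fintype W] [DecidableEq W] in
/-- **`AgreesOnCovered s odd p jc′ jcH`** — the junction of the two systems of jump constants: at every covered wall the `H`-side constant IS the predicted one, `jcH S w = bzTheta odd p jc′ S w`;
walls at definite places are unconstrained (no partner meets them). [cite: Bouaziz1994IntegralesOrbitales, Rem. 2 p. 594] [cite: Shelstad1979, Thm. 4.7 (IIIb) (p. 31)] -/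
def AgreesOnCovered (s : W → Fin 3 → SignType) (odd p : W → Fin 3) (jc' : Finset W → W → Fin 3 → Fin 3 → ℂ) (jcH : Finset W → W → ℂ) : Prop :=
  ∀ (S : Finset W) (w : W), IsCoveredWall s S w → jcH S w = bzTheta odd p jc' S w

omit [Fintype W] [DecidableEq W] in
/-- Unfolding of `AgreesOnCovered`. [cite: Shelstad1979, Thm. 4.7 (IIIb) (p. 31)] -/
theorem agreesOnCovered_iff (s : W → Fin 3 → SignType) (odd p : W → Fin 3) (jc' : Finset W → W → Fin 3 → Fin 3 → ℂ) (jcH : Finset W → W → ℂ) :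
    AgreesOnCovered s odd p jc' jcH ↔ ∀ (S : Finset W) (w : W), IsCoveredWall s S w → jcH S w = 2 * jc' S w (odd w) (p w) :=
  Iff.rfl

omit [Fintype W] [DecidableEq W] in
/-- The predicted system itself agrees (existence of an `H`-side system agreeing with any given `G′`-side one). [cite: Shelstad1979, Thm. 4.7 (IIIb) (p. 31)] -/
theorem agreesOnCovered_bzTheta (s : W → Fin 3 → SignType) (odd p : W → Fin 3) (jc' : Finset W → W → Fin 3 → Fin 3 → ℂ) :
    AgreesOnCovered s odd p jc' (bzTheta odd p jc') :=
  fun _ _ _ => rfl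

omit [Fintype W] [DecidableEq W] in
/-- At a DEFINITE place (all signs equal) no wall is covered. [cite: Rogawski1990, §14.2 p. 232] -/
theorem not_isCoveredWall_of_definite {s : W → Fin 3 → SignType} {w : W} (h : s w 0 = s w 1 ∧ s w 1 = s w 2) (S : Finset W) : ¬ IsCoveredWall s S w :=
  fun hc => hc.2 h

end Literature.NumberTheory.Rogawski1990

end
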